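import Mathlib

/-!
# Route `KPlusLogSqLaw`, crux `TropicalB` — parametric LINE FAMILIES: chains of minimisers and the HALVING INEQUALITY

HONEST FRAMING.  Helper file (seat val-sym-trop-p1 g4, cell `pub-symmetroid`, 2026-08-27) toward the registered stubs of
`Cruxes/TropicalB/Lines/birth.lean` (crux `Summit.ValiantsHypothesis.ValiantsHypothesis.Theses.KPlusLogSqLaw.TropicalB`, item
`stmt-ValiantsHypothesis-19771`), on the WALK-DESIGN route of the `K = 4` growth fork (`TropicalCensus.TropK4Law 2`: the tree's
bridge `WalkDesign.le_of_walkSystem` turns parametric-shortest-path families into tropical census rows; the companion file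
`…TropicalBWalkGusfield` bounds what bounded-WIDTH layered families can give).  KNOWN MATHEMATICS re-proved abstractly (Gusfield's
halving step); nothing here is new mathematics, nothing bounds `TropicalB` in its window, and nothing is asserted about
`WeakLifting`, `MatrixDescartes` (`stmt-ValiantsHypothesis-18050`) or `VP ≠ VNP`.

A LINE FAMILY is a type `ι` with an intercept `a : ι → ℝ` and a slope `b : ι → ℝ`; member `z` costs `a z + b z · μ` at
parameter `μ`.  The lower envelope `μ ↦ min_z (a z + b z · μ)` (when the family is finite) is concave and piecewise linear;
its number of linear pieces equals the maximal length of a CHAIN: parameters `μ₀ < ⋯ < μₙ` and members `z₀, …, zₙ` with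
`zⱼ` cheapest at `μⱼ` (`IsMinAt`) and slopes `b z₀ > ⋯ > b zₙ`.  We work in chain currency throughout (`ChainBound a b N`:
every chain has at most `N` members), which needs no finiteness and no tie-breaking.

* `slope_le_of_isMinAt` — a minimiser at a larger parameter has no larger slope (add the two minimality inequalities).
* `chainBound_one_of_subsingleton`, `ChainBound.mono`, `ChainBound.of_surjLines` (transfer along a line-preserving map
  that hits every member).
* **`chainBound_glue` — THE HALVING INEQUALITY.**  If `ι` is glued from families `X` and `Y` over a finite set of middle
  states `W` (each member has a first half in `X` and a second half in `Y` with a common middle state, its line is the sum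
  of theirs, and every compatible pair of halves is glued by some member), and over each state `w` the fibre of `X` has
  chain bound `N₁ w` and the fibre of `Y` has chain bound `N₂ w`, then `ι` has chain bound `Σ_w (N₁ w + N₂ w − 1)`.
  Proof (Gusfield 1980; the same count is Hrubeš–Yehudayoff's `σ(B_{2n}) ≤ 2·C(2n,n)·σ(B_n)` for Birkhoff shadows and the
  tree's `…KPlusLogSqLawTropicalBSplit.designRowD_split` for tropical designs): a cheapest member is glued from halves that
  are cheapest in their fibres; along the sub-chain with a fixed middle state both half-slopes are non-increasing
  (`slope_le_of_isMinAt`) and their sum drops, so the rank `#{first-half slope values above the current one} + #{second-half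
  slope values above the current one}` rises at every step; the distinct first-half slopes, sorted, form a chain of the
  fibre of `X`, and likewise for `Y`.

What is NOT here: envelopes as functions, breakpoints as a set (see `ParametricShortestPath.IsBreakpoint`), any graph.

References: D. Gusfield, *Sensitivity analysis for combinatorial optimization*, PhD thesis, UC Berkeley 1980 (the
`n^{O(log n)}` bound for parametric shortest paths; attribution via Gajjar–Radhakrishnan 2019, p. 2); P. Hrubeš,
A. Yehudayoff, *Shadows of Newton polytopes*, CCC 2021, Prop. 23.
-/

set_option linter.dupNamespace false
set_option autoImplicit false

namespace Summit.ValiantsHypothesis.ValiantsHypothesis.Theorems.KPlusLogSqLaw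

namespace ParamLines

open Finset

/-! ## 1. Line families, minimality, chains -/

section Abstract

variable {ι : Type*}

/-- `z` is a cheapest member of the line family `(a, b)` at parameter `μ` (cost `a z + b z · μ`). [folklore] -/
def IsMinAt (a b : ι → ℝ) (z : ι) (μ : ℝ) : Prop := ∀ z' : ι, a z + b z * μ ≤ a z' + b z' * μ

/-- CHAIN BOUND `N` for the line family `(a, b)`: every chain — parameters `μ₀ < ⋯ < μₙ`, members `z₀, …, zₙ` with `zⱼ`
cheapest at `μⱼ` and slopes `b z₀ > ⋯ > b zₙ` — has at most `N` members.  The number of linear pieces of the lower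
envelope `μ ↦ min_z (a z + b z μ)` is the maximal length of a chain, so `ChainBound a b N` says the envelope has at most
`N` pieces (at most `N − 1` breakpoints). [folklore] -/
def ChainBound (a b : ι → ℝ) (N : ℕ) : Prop :=
  ∀ (n : ℕ) (μ : Fin (n + 1) → ℝ) (z : Fin (n + 1) → ι), StrictMono μ → (∀ j, IsMinAt a b (z j) (μ j)) →
    StrictAnti (fun j => b (z j)) → n + 1 ≤ N

/-- Minimisers at a larger parameter have no larger slope. [folklore] -/
theorem slope_le_of_isMinAt {a b : ι → ℝ} {z z' : ι} {μ μ' : ℝ} (h : IsMinAt a b z μ) (h' : IsMinAt a b z' μ')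
    (hμ : μ < μ') : b z' ≤ b z := by
  have h1 := h z'
  have h2 := h' z
  by_contra hcon
  push Not at hcon
  nlinarith

/-- A family with at most one line has chain bound `1`. [folklore] -/
theorem chainBound_one_of_subsingleton (a b : ι → ℝ) (h : ∀ z z' : ι, b z = b z') : ChainBound a b 1 := by
  intro n μ z hμ hmin hanti
  by_contra hcon
  have hn : 0 < n := by omega
  have := hanti (show (⟨0, by omega⟩ : Fin (n + 1)) < ⟨1, by omega⟩ from Fin.mk_lt_mk.mpr Nat.zero_lt_one)
  exact absurd (h _ _) (ne_of_gt this)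

/-- Chain bounds are monotone. [folklore] -/
theorem ChainBound.mono {a b : ι → ℝ} {N N' : ℕ} (h : ChainBound a b N) (hNN' : N ≤ N') : ChainBound a b N' :=
  fun n μ z hμ hmin hanti => (h n μ z hμ hmin hanti).trans hNN'

/-- Chain bounds transfer along a map of index types that preserves lines and hits every line. [folklore] -/
theorem ChainBound.of_surjLines {κ : Type*} {a b : ι → ℝ} {a' b' : κ → ℝ} {N : ℕ} (h : ChainBound a' b' N)
    (φ : ι → κ) (ha : ∀ z, a z = a' (φ z)) (hb : ∀ z, b z = b' (φ z))
    (hsurj : ∀ w : κ, ∃ z : ι, φ z = w) : ChainBound a b N := by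
  intro n μ z hμ hmin hanti
  refine h n μ (fun j => φ (z j)) hμ ?_ ?_
  · intro j w
    obtain ⟨z', rfl⟩ := hsurj w
    have := hmin j z'
    rw [ha, hb, ha z', hb z'] at this
    exact this
  · intro j j' hjj'
    have := hanti hjj'
    simp only [hb] at this
    exact this

end Abstract

/-! ## 2. The halving inequality for glued families -/

section Halving

variable {ι X Y W : Type*} [Fintype W] [DecidableEq W]

/-- **HALVING INEQUALITY.**  Let the line family `ι` be glued from families `X` and `Y` over a finite set of middle states
`W`: every `z : ι` has a first half `fst z : X` and a second half `snd z : Y` with the same middle state, its line is the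
sum of theirs, and conversely every compatible pair is glued by some member.  If for every state `w` the fibre of `X`
over `w` has chain bound `N₁ w` and the fibre of `Y` has chain bound `N₂ w`, then `ι` has chain bound
`Σ_w (N₁ w + N₂ w − 1)`.  (Gusfield's step: a cheapest path is glued from cheapest halves; along a chain with a fixed
middle state both half-slopes are non-increasing and one of them drops at every step.) [folklore] -/
theorem chainBound_glue (a b : ι → ℝ) (a₁ b₁ : X → ℝ) (a₂ b₂ : Y → ℝ) (fst : ι → X) (snd : ι → Y)
    (midX : X → W) (midY : Y → W) (hmid : ∀ z, midX (fst z) = midY (snd z))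
    (ha : ∀ z, a z = a₁ (fst z) + a₂ (snd z)) (hb : ∀ z, b z = b₁ (fst z) + b₂ (snd z))
    (hglue : ∀ x y, midX x = midY y → ∃ z, fst z = x ∧ snd z = y)
    (N₁ N₂ : W → ℕ)
    (h₁ : ∀ w, ChainBound (fun x : {x : X // midX x = w} => a₁ x.1) (fun x => b₁ x.1) (N₁ w))
    (h₂ : ∀ w, ChainBound (fun y : {y : Y // midY y = w} => a₂ y.1) (fun y => b₂ y.1) (N₂ w)) :
    ChainBound a b (∑ w, (N₁ w + N₂ w - 1)) := by
  classical
  intro n μ z hμ hmin hanti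
  -- notation
  set x : Fin (n + 1) → X := fun j => fst (z j) with hx
  set y : Fin (n + 1) → Y := fun j => snd (z j) with hy
  set st : Fin (n + 1) → W := fun j => midX (x j) with hst
  -- (a) halves of cheapest members are cheapest in their fibres
  have hminx : ∀ j (x' : X), midX x' = st j → a₁ (x j) + b₁ (x j) * μ j ≤ a₁ x' + b₁ x' * μ j := by
    intro j x' hx'
    obtain ⟨z', h1, h2⟩ := hglue x' (y j) (by rw [hx', hst]; exact hmid (z j))
    have := hmin j z'
    rw [ha, hb, ha z', hb z', h1, h2] at this
    simp only [hx, hy] at this ⊢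
    linarith
  have hsty : ∀ j, midY (y j) = st j := fun j => (hmid (z j)).symm
  have hminy : ∀ j (y' : Y), midY y' = st j → a₂ (y j) + b₂ (y j) * μ j ≤ a₂ y' + b₂ y' * μ j := by
    intro j y' hy'
    obtain ⟨z', h1, h2⟩ := hglue (x j) y' (by rw [hy'])
    have := hmin j z'
    rw [ha, hb, ha z', hb z', h1, h2] at this
    simp only [hx, hy] at this ⊢
    linarith
  -- (b) within a fibre, half-slopes are non-increasing
  have hb₁anti : ∀ j j', j < j' → st j = st j' → b₁ (x j') ≤ b₁ (x j) := by
    intro j j' hjj' hs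
    have h1 := hminx j (x j') hs.symm
    have h2 := hminx j' (x j) hs
    have hμ' := hμ hjj'
    by_contra hcon; push Not at hcon; nlinarith
  have hb₂anti : ∀ j j', j < j' → st j = st j' → b₂ (y j') ≤ b₂ (y j) := by
    intro j j' hjj' hs
    have h1 := hminy j (y j') ((hsty j').trans hs.symm)
    have h2 := hminy j' (y j) ((hsty j).trans hs)
    have hμ' := hμ hjj'
    by_contra hcon; push Not at hcon; nlinarith
  -- one of the two half-slopes drops at every step inside a fibre
  have hdrop : ∀ j j', j < j' → st j = st j' → b₁ (x j') < b₁ (x j) ∨ b₂ (y j') < b₂ (y j) := by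
    intro j j' hjj' hs
    have := hanti hjj'
    simp only [hb] at this
    rcases (hb₁anti j j' hjj' hs).lt_or_eq with h | h
    · exact Or.inl h
    · right; simp only [hx, hy] at h ⊢; linarith
  -- (c) fibres of the chain
  set J : W → Finset (Fin (n + 1)) := fun w => univ.filter fun j => st j = w with hJ
  have hsum : ∑ w, (J w).card = n + 1 := by
    have h := Finset.card_eq_sum_card_fiberwise (f := st) (s := (univ : Finset (Fin (n + 1))))
      (t := (univ : Finset W)) (fun _ _ => mem_univ _)
    rw [card_univ, Fintype.card_fin] at h
    exact h.symm
  -- (d) the bound fibre by fibre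
  have hfib : ∀ w, (J w).card ≤ N₁ w + N₂ w - 1 := by
    intro w
    rcases (J w).eq_empty_or_nonempty with he | hne
    · rw [he, card_empty]; exact Nat.zero_le _
    -- distinct half-slope values in the fibre
    set S₁ : Finset ℝ := (J w).image fun j => b₁ (x j) with hS₁
    set S₂ : Finset ℝ := (J w).image fun j => b₂ (y j) with hS₂
    have hmemJ : ∀ {j}, j ∈ J w ↔ st j = w := by intro j; simp [hJ]
    -- |S₁| ≤ N₁ w : the distinct first-half slopes, sorted decreasingly, form a chain in the fibre of `X`
    have hS₁card : S₁.card ≤ N₁ w := by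
      set k := S₁.card with hk
      have hkpos : 0 < k := by
        rw [hk, card_pos, hS₁]; exact hne.image _
      -- representatives
      have hrep : ∀ v : S₁, ∃ j, j ∈ J w ∧ b₁ (x j) = v.1 := by
        intro v; obtain ⟨j, hj, hv⟩ := mem_image.mp v.2; exact ⟨j, hj, hv⟩
      choose rep hrepJ hrepv using hrep
      -- order isomorphism `Fin k ≃o S₁` (increasing); we run through it backwards
      let e : Fin k ≃o S₁ := S₁.orderIsoOfFin hk.symm
      let idx : Fin k → Fin k := fun i => Fin.rev i
      let jj : Fin k → Fin (n + 1) := fun i => rep (e (idx i))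
      have hval : ∀ i, b₁ (x (jj i)) = (e (idx i)).1 := fun i => hrepv _
      have hvanti : StrictAnti fun i => b₁ (x (jj i)) := by
        intro i i' hii'
        simp only [hval]
        have : idx i' < idx i := by simp only [idx]; exact Fin.rev_lt_rev.mpr hii'
        exact_mod_cast (e.strictMono this)
      have hjmono : StrictMono jj := by
        intro i i' hii'
        have hv := hvanti hii'
        by_contra hcon; push Not at hcon
        rcases hcon.lt_or_eq with hlt | heq
        · have := hb₁anti _ _ hlt ((hmemJ.mp (hrepJ _)).trans (hmemJ.mp (hrepJ _)).symm)
          simp only at hv; linarith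
        · simp only at hv; rw [heq] at hv; exact lt_irrefl _ hv
      obtain ⟨k', hk'⟩ : ∃ k', k = k' + 1 := ⟨k - 1, by omega⟩
      have hch := h₁ w k' (fun i => μ (jj (Fin.cast hk'.symm i)))
        (fun i => ⟨x (jj (Fin.cast hk'.symm i)), hmemJ.mp (hrepJ _)⟩)
        (fun i i' hii' => hμ (hjmono (by simpa using hii')))
        (fun i x' => hminx _ x'.1 (x'.2.trans (hmemJ.mp (hrepJ _)).symm))
        (fun i i' hii' => hvanti (by simpa using hii'))
      omega
    have hS₂card : S₂.card ≤ N₂ w := by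
      set k := S₂.card with hk
      have hkpos : 0 < k := by
        rw [hk, card_pos, hS₂]; exact hne.image _
      have hrep : ∀ v : S₂, ∃ j, j ∈ J w ∧ b₂ (y j) = v.1 := by
        intro v; obtain ⟨j, hj, hv⟩ := mem_image.mp v.2; exact ⟨j, hj, hv⟩
      choose rep hrepJ hrepv using hrep
      let e : Fin k ≃o S₂ := S₂.orderIsoOfFin hk.symm
      let idx : Fin k → Fin k := fun i => Fin.rev i
      let jj : Fin k → Fin (n + 1) := fun i => rep (e (idx i))
      have hval : ∀ i, b₂ (y (jj i)) = (e (idx i)).1 := fun i => hrepv _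
      have hvanti : StrictAnti fun i => b₂ (y (jj i)) := by
        intro i i' hii'
        simp only [hval]
        have : idx i' < idx i := by simp only [idx]; exact Fin.rev_lt_rev.mpr hii'
        exact_mod_cast (e.strictMono this)
      have hjmono : StrictMono jj := by
        intro i i' hii'
        have hv := hvanti hii'
        by_contra hcon; push Not at hcon
        rcases hcon.lt_or_eq with hlt | heq
        · have := hb₂anti _ _ hlt ((hmemJ.mp (hrepJ _)).trans (hmemJ.mp (hrepJ _)).symm)
          simp only at hv; linarith
        · simp only at hv; rw [heq] at hv; exact lt_irrefl _ hv
      have hmidy : ∀ i, midY (y (jj i)) = w := by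
        intro i
        have e1 := hmid (z (jj i))
        have : st (jj i) = w := hmemJ.mp (hrepJ _)
        simp only [hx, hy, hst] at e1 this ⊢
        rw [← e1, this]
      obtain ⟨k', hk'⟩ : ∃ k', k = k' + 1 := ⟨k - 1, by omega⟩
      have hch := h₂ w k' (fun i => μ (jj (Fin.cast hk'.symm i)))
        (fun i => ⟨y (jj (Fin.cast hk'.symm i)), hmidy _⟩)
        (fun i i' hii' => hμ (hjmono (by simpa using hii')))
        (fun i y' => hminy _ y'.1 (y'.2.trans (hmemJ.mp (hrepJ _)).symm))
        (fun i i' hii' => hvanti (by simpa using hii'))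
      omega
    -- |J w| ≤ |S₁| + |S₂| − 1 : the rank function is strictly increasing along the fibre
    let r : Fin (n + 1) → ℕ := fun j =>
      (S₁.filter fun v => b₁ (x j) < v).card + (S₂.filter fun v => b₂ (y j) < v).card
    have hr_lt : ∀ j ∈ J w, r j < S₁.card + S₂.card - 1 := by
      intro j hj
      have h1 : (S₁.filter fun v => b₁ (x j) < v).card < S₁.card := by
        apply card_lt_card
        refine (ssubset_iff_of_subset (filter_subset _ _)).mpr ⟨b₁ (x j), ?_, ?_⟩
        · rw [hS₁]; exact mem_image_of_mem _ hj
        · simp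
      have h2 : (S₂.filter fun v => b₂ (y j) < v).card < S₂.card := by
        apply card_lt_card
        refine (ssubset_iff_of_subset (filter_subset _ _)).mpr ⟨b₂ (y j), ?_, ?_⟩
        · rw [hS₂]; exact mem_image_of_mem _ hj
        · simp
      simp only [r]; omega
    have hr_mono : ∀ j ∈ J w, ∀ j' ∈ J w, j < j' → r j < r j' := by
      intro j hj j' hj' hjj'
      have hs : st j = st j' := (hmemJ.mp hj).trans (hmemJ.mp hj').symm
      have m1 : (S₁.filter fun v => b₁ (x j) < v) ⊆ (S₁.filter fun v => b₁ (x j') < v) := by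
        intro v hv; rw [mem_filter] at hv ⊢; exact ⟨hv.1, (hb₁anti j j' hjj' hs).trans_lt hv.2⟩
      have m2 : (S₂.filter fun v => b₂ (y j) < v) ⊆ (S₂.filter fun v => b₂ (y j') < v) := by
        intro v hv; rw [mem_filter] at hv ⊢; exact ⟨hv.1, (hb₂anti j j' hjj' hs).trans_lt hv.2⟩
      rcases hdrop j j' hjj' hs with hd | hd
      · have s1 : (S₁.filter fun v => b₁ (x j) < v) ⊂ (S₁.filter fun v => b₁ (x j') < v) := by
          refine (ssubset_iff_of_subset m1).mpr ⟨b₁ (x j), ?_, ?_⟩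
          · rw [mem_filter]; exact ⟨by rw [hS₁]; exact mem_image_of_mem _ hj, hd⟩
          · simp
        have := card_lt_card s1; have := card_le_card m2; simp only [r]; omega
      · have s2 : (S₂.filter fun v => b₂ (y j) < v) ⊂ (S₂.filter fun v => b₂ (y j') < v) := by
          refine (ssubset_iff_of_subset m2).mpr ⟨b₂ (y j), ?_, ?_⟩
          · rw [mem_filter]; exact ⟨by rw [hS₂]; exact mem_image_of_mem _ hj, hd⟩
          · simp
        have := card_lt_card s2; have := card_le_card m1; simp only [r]; omega
    have hinj : Set.InjOn r (J w) := by
      intro j hj j' hj' hrr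
      by_contra hne'
      rcases lt_or_gt_of_ne hne' with h | h
      · exact absurd hrr (ne_of_lt (hr_mono j hj j' hj' h))
      · exact absurd hrr (ne_of_gt (hr_mono j' hj' j hj h))
    have hcardJ : (J w).card ≤ S₁.card + S₂.card - 1 := by
      have := card_le_card_of_injOn r (fun j hj => mem_range.mpr (hr_lt j hj)) hinj
      simpa using this
    calc (J w).card ≤ S₁.card + S₂.card - 1 := hcardJ
      _ ≤ N₁ w + N₂ w - 1 := by omega
  calc n + 1 = ∑ w, (J w).card := hsum.symm
    _ ≤ ∑ w, (N₁ w + N₂ w - 1) := sum_le_sum fun w _ => hfib w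

end Halving

end ParamLines

end Summit.ValiantsHypothesis.ValiantsHypothesis.Theorems.KPlusLogSqLaw
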